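import Summits.BirchSwinnertonDyer.BirchSwinnertonDyer.Theorems.AlignedTransportAtTwoMainConjectureOfRankZeroBSDAtTwoCubicOrderFourRowN13971Certs
import HarnessLib

/-!
# Route `AlignedTransportAtTwo`, crux C2 `MainConjectureOfRankZeroBSDAtTwo` (stmt-BirchSwinnertonDyer-22298):
# `e₁ = ord₂ h(ℚ(β,√2)) ≥ 2` IN THE KERNEL for the cubic `2`-torsion field of `⟨1, 1, 0, -122, -573⟩` (`N = 13971`, `t = 4`, regime (α)) —
# the ORDER-FOUR CERTIFICATE decided in `ℤ[θ]`: three units of `ℚ(β,√2)` modulo `±` squares and the prime `(q₀, √2 − 8)` above `31` of order `4`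

HONEST FRAMING (cell `bsd-f1-sign2`, WIDTH-5 attached prover seat `bsd-line-att-p4` gen 40 on line `birth` of the lead `bsd-line-att-p2`;
`--supports` stmt-BirchSwinnertonDyer-22298, closes nothing; BSD is NOT proved by any of this; the crux C2, its verdict «blocked-on
`Rank1Residual.GreenbergMuConjectureIrreducible`» and every registered stub are untouched).  THEOREMS ONLY (no `def`, no named fact, no instance, no `sorry`).

WHAT.  `W = ⟨1, 1, 0, -122, -573⟩` (`Δ_min = −13971 ≡ 5 (mod 8)`, rank `0`) is a rank-0 seed of the u7 sub-cell with `e₁ = ord₂ h(K₁) ≥ 2` (`K₁ = ℚ(β,√2)`;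
unit depth `t = 4`, genus regime (α)) — layer-two territory (`t = 4`, regime (α), `s = 2` customer of att-p3 g44's layer-two unit door); `e₁ ≥ 2` was census-grade.  The order-four door of this seat (`…CubicOrderFourDoor`; Literature
`NumberFields/QuadraticSqrtTwoClassNumberDvdFourCertificate`, `IwasawaTheory/ClassNumberPExpLayerOneGeTwoOfOrderFourCertificate`) makes `e₁ ≥ 2` a KERNEL
theorem with every datum decided in `𝓞_{ℚ(β)} = ℤ[θ]` (`f = X³ + X² + 15X + 12`; att-p4 g38/g39 `…AlignedTransportAtTwoMainConjectureOfRankZeroBSDAtTwoCubicDoorsDeadSubcellClassNumberJ` / `CubicDisc13971`): with `s = √2`,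
* three UNITS of `K₁` modulo `±` squares: `u₁ = (1) + (1)·s` (inverse `(-1) + (1)·s`), `u₂ = (-99 − 176θ + 68θ²) + (190 + 126θ − 40θ²)·s` (inverse `(-99 − 176θ + 68θ²) + (-190 − 126θ + 40θ²)·s`), `u₃ = (-45693 − 590θ − 3078θ²) + (533918 + 6893θ + 35966θ²)·s` (inverse `(61923 + 82654θ + 7484θ²) + (43786 + 58445θ + 5292θ²)·s`);
* the split prime `(q₀)`, `q₀ = 89 + θ + 6θ²` of norm `31` (`θ ≡ 13`), the prime `𝔔 = (q₀, s − 8)` of `K₁` above it and `w = (-29 − 48θ − 15θ²) + (18 + 36θ + 17θ²)·s` with `(w) = 𝔔⁴`,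
  certified by the ideal identities `(q₀, s − 8)² = (w, q₀²)`, `(w, q₀²)² = (w)` (ring witnesses in `ℤ[θ][s]` found by lattice reduction);
* `31` RESIDUE CERTIFICATES at degree-one primes above `17`, `31`: no `±u₁^{e₁}u₂^{e₂}u₃^{e₃}w^{e₄}` with `(e,±) ≠ (0,+)` is a square in `K₁` — so
  (Dirichlet: `rank E_{K₁} = 3`, `√−1 ∉ K₁`) `(w, q₀²) = 𝔔²` is NOT principal and `[𝔔]` has order `4`: `4 ∣ h(K₁)`.
Numerics behind the data (pure python, seat folder `tools/certgen.py` + `tools/o4rel.py`; each identity re-verified exactly and, here, by the kernel): the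
S-unit relation lattice of `K₁` has determinant `4` (`h(K₁)`, heuristic), consistent with `e₁ = 2` exactly.

THEN (★ `two_le_classNumberPExp_one_cubicField_n13971`, THIS FILE = part 3 of 3; data in `…RowN13971Data`, certificates in `…RowN13971Certs`) `e₁(κ) ≥ 2` for every
cyclotomic `ℤ₂`-extension `κ` of `ℚ(β)` — UNCONDITIONAL.  Nothing is asserted about `μ₂` or `MC₂` for this curve; BSD is NOT proved; nothing is closed.

References: [NeukirchANT1999] I §3, §7 (7.4), §8; [Cohen1993] §4.7, §6.5, Prop. 4.8.11; [Marcus2018] Ch. 3 Thm. 27; [Washington1997] §13.1;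
[LMFDB] nf 3.1.13971.1, ec 13971; tree: this seat's `…CubicOrderFourDoor`, `…AlignedTransportAtTwoMainConjectureOfRankZeroBSDAtTwoCubicDoorsDeadSubcellClassNumberJ`, `Literature/NumberTheory/CubicFields/CubicFieldDiscriminant13971*`,
`MonicCubic.exists_ringHom_of_root`.
-/

set_option linter.dupNamespace false
set_option autoImplicit false

noncomputable section

open scoped Classical NumberField nonZeroDivisors IntermediateField

namespace Summit.BirchSwinnertonDyer.BirchSwinnertonDyer.Theorems.AlignedTransportAtTwoCubicOrderFourRowN13971

open NumberField IsDedekindDomain Polynomial WeierstrassCurve IntermediateField CongruenceSubgroup Module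
  Literature.NumberTheory.IwasawaTheory Literature.NumberTheory.GaloisRepresentations
  Literature.NumberTheory.EllipticCurves Literature.NumberTheory.EllipticCurves.Greenberg1999
  Literature.NumberTheory.EllipticCurves.ModularForms Literature.NumberTheory.EllipticCurves.Rank1Residual
  Literature.NumberTheory.EllipticCurves.Module
  Literature.NumberTheory.NumberFields Literature.NumberTheory.CubicFields
  Summit.BirchSwinnertonDyer.Rank1Residual Summit.BirchSwinnertonDyer.Rank1Residual.X1.MuLambda
  Summit.BirchSwinnertonDyer.Rank1Residual.X5 Summit.BirchSwinnertonDyer.Rank1Residual.X5.O1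
  Summit.BirchSwinnertonDyer.Rank1Residual.X5.Instances Summit.BirchSwinnertonDyer.Rank1Residual.F1Sign2
  Summit.BirchSwinnertonDyer.BirchSwinnertonDyer.Theorems.Rank1ResidualX1Defs
  Summit.BirchSwinnertonDyer.BirchSwinnertonDyer.Theses.AlignedTransportAtTwo
  Summit.BirchSwinnertonDyer.BirchSwinnertonDyer.Theorems.AlignedTransportAtTwoCubicOrderFourDoor
  Summit.BirchSwinnertonDyer.BirchSwinnertonDyer.Theorems.AlignedTransportAtTwoCubicDoorsDeadSubcellClassNumberJ

/-! ## `e₁ ≥ 2` for the cubic field of discriminant `−13971` — UNCONDITIONAL -/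

/-- ★ **`e₁ = ord₂ h(ℚ(β,√2)) ≥ 2`** for the cubic `2`-torsion field of `⟨1, 1, 0, -122, -573⟩` (discriminant `−13971`) and every cyclotomic `ℤ₂`-extension `κ`:
the order-four certificate (three units modulo `±` squares by `31` residue certificates, the prime `(q₀, √2 − 8)` above `31` of order `4`) decided in
`ℤ[θ]` and `ℤ/q`, `q ∈ {17, 31}`. [cite: NeukirchANT1999, Ch. I §7 Thm. (7.4), Ch. I §3, Ch. I §8] [cite: Cohen1993, §6.5]
[cite: LMFDB, number field 3.1.13971.1 (class number 1); elliptic curve 13971 (conductor 13971)] [cite: Marcus2018, Ch. 3, Thm. 27] -/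
theorem two_le_classNumberPExp_one_cubicField_n13971 {β : AlgebraicClosure ℚ} (hβ : aeval β ((⟨1, 1, 0, -122, -573⟩ : WeierstrassCurve ℤ).baseChange ℚ).twoTorsionPolynomial.toPoly = 0)
    (κP : ZpExtension ↥(IntermediateField.adjoin ℚ ({β} : Set (AlgebraicClosure ℚ))) 2) (hκP : κP.IsCyclotomic) :
    2 ≤ classNumberPExp κP 1 := by
  haveI := isElliptic_n13971
  haveI : FiniteDimensional ℚ ↥(IntermediateField.adjoin ℚ ({β} : Set (AlgebraicClosure ℚ))) := IntermediateField.adjoin.finiteDimensional ((AlgebraicClosure.isAlgebraic ℚ).isAlgebraic β).isIntegral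
  haveI : NumberField ↥(IntermediateField.adjoin ℚ ({β} : Set (AlgebraicClosure ℚ))) := NumberField.mk
  have hd : ¬ (2 : ℤ) ∣ NumberField.discr ↥(IntermediateField.adjoin ℚ ({β} : Set (AlgebraicClosure ℚ))) := by
    rw [CubicDisc13971.discr_eq (finrank_cubicField_n13971 hβ) (aeval_theta_n13971 hβ)]; norm_num
  set θI : 𝓞 ↥(IntermediateField.adjoin ℚ ({β} : Set (AlgebraicClosure ℚ))) := MonicCubic.thetaInt (aeval_theta_n13971 hβ) with hθI
  have hcert : ∀ (e₁ e₂ e₃ e₄ : ℕ) (σ : ℤˣ), e₁ ≤ 1 → e₂ ≤ 1 → e₃ ≤ 1 → e₄ ≤ 1 →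
      ¬ (e₁ = 0 ∧ e₂ = 0 ∧ e₃ = 0 ∧ e₄ = 0 ∧ σ = 1) →
      ∃ (q : ℕ) (ψ : 𝓞 ↥(IntermediateField.adjoin ℚ ({β} : Set (AlgebraicClosure ℚ))) →+* ZMod q) (t : ZMod q) (ρ : 𝓞 ↥(IntermediateField.adjoin ℚ ({β} : Set (AlgebraicClosure ℚ)))), 2 * t = 1 ∧ ψ ρ ^ 2 = 2 ∧
        ¬ IsSquare (((σ : ℤ) : ZMod q) * (ψ ((1 : 𝓞 ↥(IntermediateField.adjoin ℚ ({β} : Set (AlgebraicClosure ℚ)))) + (0 : 𝓞 ↥(IntermediateField.adjoin ℚ ({β} : Set (AlgebraicClosure ℚ)))) * θI + (0 : 𝓞 ↥(IntermediateField.adjoin ℚ ({β} : Set (AlgebraicClosure ℚ)))) * θI ^ 2) + ψ ((1 : 𝓞 ↥(IntermediateField.adjoin ℚ ({β} : Set (AlgebraicClosure ℚ)))) + (0 : 𝓞 ↥(IntermediateField.adjoin ℚ ({β} : Set (AlgebraicClosure ℚ)))) * θI + (0 : 𝓞 ↥(IntermediateField.adjoin ℚ ({β} : Set (AlgebraicClosure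 ℚ)))) * θI ^ 2) * ψ ρ) ^ e₁ * (ψ ((-99 : 𝓞 ↥(IntermediateField.adjoin ℚ ({β} : Set (AlgebraicClosure ℚ)))) + (-176 : 𝓞 ↥(IntermediateField.adjoin ℚ ({β} : Set (AlgebraicClosure ℚ)))) * θI + (68 : 𝓞 ↥(IntermediateField.adjoin ℚ ({β} : Set (AlgebraicClosure ℚ)))) * θI ^ 2) + ψ ((190 : 𝓞 ↥(IntermediateField.adjoin ℚ ({β} : Set (AlgebraicClosure ℚ)))) + (126 : 𝓞 ↥(IntermediateField.adjoin ℚ ({β} : Set (AlgebraicClosure ℚ)))) * θI + (-40 : 𝓞 ↥(IntermediateField.adjoin ℚ ({β} : Set (AlgebraicClosure ℚ)))) * θI ^ 2) * ψ ρ) ^ e₂ * (ψ ((-45693 : 𝓞 ↥(IntermediateField.adjoin ℚ ({β} : Set (AlgebraicClosure ℚ)))) + (-590 : 𝓞 ↥(IntermediateField.adjoin ℚ ({β} : Set (AlgebraicClosure ℚ)))) * θI + (-3078 : 𝓞 ↥(IntermediateField.adjoin ℚ ({β} : Set (AlgebraicClosure ℚ)))) * θI ^ 2) + ψ ((533918 :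 𝓞 ↥(IntermediateField.adjoin ℚ ({β} : Set (AlgebraicClosure ℚ)))) + (6893 : 𝓞 ↥(IntermediateField.adjoin ℚ ({β} : Set (AlgebraicClosure ℚ)))) * θI + (35966 : 𝓞 ↥(IntermediateField.adjoin ℚ ({β} : Set (AlgebraicClosure ℚ)))) * θI ^ 2) * ψ ρ) ^ e₃ * (ψ ((-29 : 𝓞 ↥(IntermediateField.adjoin ℚ ({β} : Set (AlgebraicClosure ℚ)))) + (-48 : 𝓞 ↥(IntermediateField.adjoin ℚ ({β} : Set (AlgebraicClosure ℚ)))) * θI + (-15 : 𝓞 ↥(IntermediateField.adjoin ℚ ({β} : Set (AlgebraicClosure ℚ)))) * θI ^ 2) + ψ ((18 : 𝓞 ↥(IntermediateField.adjoin ℚ ({β} : Set (AlgebraicClosure ℚ)))) + (36 : 𝓞 ↥(IntermediateField.adjoin ℚ ({β} : Set (AlgebraicClosure ℚ)))) * θI + (17 : 𝓞 ↥(IntermediateField.adjoin ℚ ({β} : Set (AlgebraicClosure ℚ)))) * θI ^ 2) * ψ ρ) ^ e₄) := by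
    intro e₁ e₂ e₃ e₄ σ h₁ h₂ h₃ h₄ hne
    rcases Nat.le_one_iff_eq_zero_or_eq_one.mp h₁ with rfl | rfl <;>
    rcases Nat.le_one_iff_eq_zero_or_eq_one.mp h₂ with rfl | rfl <;>
    rcases Nat.le_one_iff_eq_zero_or_eq_one.mp h₃ with rfl | rfl <;>
    rcases Nat.le_one_iff_eq_zero_or_eq_one.mp h₄ with rfl | rfl <;>
    rcases Int.units_eq_one_or σ with rfl | rfl
    · exact absurd ⟨rfl, rfl, rfl, rfl, rfl⟩ hne
    · exact cert_0000m_n13971 hβ hθI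
    · exact cert_0001p_n13971 hβ hθI
    · exact cert_0001m_n13971 hβ hθI
    · exact cert_0010p_n13971 hβ hθI
    · exact cert_0010m_n13971 hβ hθI
    · exact cert_0011p_n13971 hβ hθI
    · exact cert_0011m_n13971 hβ hθI
    · exact cert_0100p_n13971 hβ hθI
    · exact cert_0100m_n13971 hβ hθI
    · exact cert_0101p_n13971 hβ hθI
    · exact cert_0101m_n13971 hβ hθI
    · exact cert_0110p_n13971 hβ hθI
    · exact cert_0110m_n13971 hβ hθI
    · exact cert_0111p_n13971 hβ hθI
    · exact cert_0111m_n13971 hβ hθI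
    · exact cert_1000p_n13971 hβ hθI
    · exact cert_1000m_n13971 hβ hθI
    · exact cert_1001p_n13971 hβ hθI
    · exact cert_1001m_n13971 hβ hθI
    · exact cert_1010p_n13971 hβ hθI
    · exact cert_1010m_n13971 hβ hθI
    · exact cert_1011p_n13971 hβ hθI
    · exact cert_1011m_n13971 hβ hθI
    · exact cert_1100p_n13971 hβ hθI
    · exact cert_1100m_n13971 hβ hθI
    · exact cert_1101p_n13971 hβ hθI
    · exact cert_1101m_n13971 hβ hθI
    · exact cert_1110p_n13971 hβ hθI
    · exact cert_1110m_n13971 hβ hθI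
    · exact cert_1111p_n13971 hβ hθI
    · exact cert_1111m_n13971 hβ hθI
  exact two_le_classNumberPExp_one_adjoin_of_orderFourCert ((⟨1, 1, 0, -122, -573⟩ : WeierstrassCurve ℤ).baseChange ℚ) not_hasRationalTwoTorsionX_n13971 Δ_n13971_neg hβ hd
    (a₁ := ((1 : 𝓞 ↥(IntermediateField.adjoin ℚ ({β} : Set (AlgebraicClosure ℚ)))) + (0 : 𝓞 ↥(IntermediateField.adjoin ℚ ({β} : Set (AlgebraicClosure ℚ)))) * θI + (0 : 𝓞 ↥(IntermediateField.adjoin ℚ ({β} : Set (AlgebraicClosure ℚ)))) * θI ^ 2))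
    (b₁ := ((1 : 𝓞 ↥(IntermediateField.adjoin ℚ ({β} : Set (AlgebraicClosure ℚ)))) + (0 : 𝓞 ↥(IntermediateField.adjoin ℚ ({β} : Set (AlgebraicClosure ℚ)))) * θI + (0 : 𝓞 ↥(IntermediateField.adjoin ℚ ({β} : Set (AlgebraicClosure ℚ)))) * θI ^ 2))
    (c₁ := ((-1 : 𝓞 ↥(IntermediateField.adjoin ℚ ({β} : Set (AlgebraicClosure ℚ)))) + (0 : 𝓞 ↥(IntermediateField.adjoin ℚ ({β} : Set (AlgebraicClosure ℚ)))) * θI + (0 : 𝓞 ↥(IntermediateField.adjoin ℚ ({β} : Set (AlgebraicClosure ℚ)))) * θI ^ 2))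
    (d₁ := ((1 : 𝓞 ↥(IntermediateField.adjoin ℚ ({β} : Set (AlgebraicClosure ℚ)))) + (0 : 𝓞 ↥(IntermediateField.adjoin ℚ ({β} : Set (AlgebraicClosure ℚ)))) * θI + (0 : 𝓞 ↥(IntermediateField.adjoin ℚ ({β} : Set (AlgebraicClosure ℚ)))) * θI ^ 2))
    (a₂ := ((-99 : 𝓞 ↥(IntermediateField.adjoin ℚ ({β} : Set (AlgebraicClosure ℚ)))) + (-176 : 𝓞 ↥(IntermediateField.adjoin ℚ ({β} : Set (AlgebraicClosure ℚ)))) * θI + (68 : 𝓞 ↥(IntermediateField.adjoin ℚ ({β} : Set (AlgebraicClosure ℚ)))) * θI ^ 2))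
    (b₂ := ((190 : 𝓞 ↥(IntermediateField.adjoin ℚ ({β} : Set (AlgebraicClosure ℚ)))) + (126 : 𝓞 ↥(IntermediateField.adjoin ℚ ({β} : Set (AlgebraicClosure ℚ)))) * θI + (-40 : 𝓞 ↥(IntermediateField.adjoin ℚ ({β} : Set (AlgebraicClosure ℚ)))) * θI ^ 2))
    (c₂ := ((-99 : 𝓞 ↥(IntermediateField.adjoin ℚ ({β} : Set (AlgebraicClosure ℚ)))) + (-176 : 𝓞 ↥(IntermediateField.adjoin ℚ ({β} : Set (AlgebraicClosure ℚ)))) * θI + (68 : 𝓞 ↥(IntermediateField.adjoin ℚ ({β} : Set (AlgebraicClosure ℚ)))) * θI ^ 2))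
    (d₂ := ((-190 : 𝓞 ↥(IntermediateField.adjoin ℚ ({β} : Set (AlgebraicClosure ℚ)))) + (-126 : 𝓞 ↥(IntermediateField.adjoin ℚ ({β} : Set (AlgebraicClosure ℚ)))) * θI + (40 : 𝓞 ↥(IntermediateField.adjoin ℚ ({β} : Set (AlgebraicClosure ℚ)))) * θI ^ 2))
    (a₃ := ((-45693 : 𝓞 ↥(IntermediateField.adjoin ℚ ({β} : Set (AlgebraicClosure ℚ)))) + (-590 : 𝓞 ↥(IntermediateField.adjoin ℚ ({β} : Set (AlgebraicClosure ℚ)))) * θI + (-3078 : 𝓞 ↥(IntermediateField.adjoin ℚ ({β} : Set (AlgebraicClosure ℚ)))) * θI ^ 2))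
    (b₃ := ((533918 : 𝓞 ↥(IntermediateField.adjoin ℚ ({β} : Set (AlgebraicClosure ℚ)))) + (6893 : 𝓞 ↥(IntermediateField.adjoin ℚ ({β} : Set (AlgebraicClosure ℚ)))) * θI + (35966 : 𝓞 ↥(IntermediateField.adjoin ℚ ({β} : Set (AlgebraicClosure ℚ)))) * θI ^ 2))
    (c₃ := ((61923 : 𝓞 ↥(IntermediateField.adjoin ℚ ({β} : Set (AlgebraicClosure ℚ)))) + (82654 : 𝓞 ↥(IntermediateField.adjoin ℚ ({β} : Set (AlgebraicClosure ℚ)))) * θI + (7484 : 𝓞 ↥(IntermediateField.adjoin ℚ ({β} : Set (AlgebraicClosure ℚ)))) * θI ^ 2))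
    (d₃ := ((43786 : 𝓞 ↥(IntermediateField.adjoin ℚ ({β} : Set (AlgebraicClosure ℚ)))) + (58445 : 𝓞 ↥(IntermediateField.adjoin ℚ ({β} : Set (AlgebraicClosure ℚ)))) * θI + (5292 : 𝓞 ↥(IntermediateField.adjoin ℚ ({β} : Set (AlgebraicClosure ℚ)))) * θI ^ 2))
    (A := ((-29 : 𝓞 ↥(IntermediateField.adjoin ℚ ({β} : Set (AlgebraicClosure ℚ)))) + (-48 : 𝓞 ↥(IntermediateField.adjoin ℚ ({β} : Set (AlgebraicClosure ℚ)))) * θI + (-15 : 𝓞 ↥(IntermediateField.adjoin ℚ ({β} : Set (AlgebraicClosure ℚ)))) * θI ^ 2))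
    (B := ((18 : 𝓞 ↥(IntermediateField.adjoin ℚ ({β} : Set (AlgebraicClosure ℚ)))) + (36 : 𝓞 ↥(IntermediateField.adjoin ℚ ({β} : Set (AlgebraicClosure ℚ)))) * θI + (17 : 𝓞 ↥(IntermediateField.adjoin ℚ ({β} : Set (AlgebraicClosure ℚ)))) * θI ^ 2))
    (W₀ := ((397538491 : 𝓞 ↥(IntermediateField.adjoin ℚ ({β} : Set (AlgebraicClosure ℚ)))) + (5132258 : 𝓞 ↥(IntermediateField.adjoin ℚ ({β} : Set (AlgebraicClosure ℚ)))) * θI + (26779143 : 𝓞 ↥(IntermediateField.adjoin ℚ ({β} : Set (AlgebraicClosure ℚ)))) * θI ^ 2))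
    (W₁ := ((4530539334 : 𝓞 ↥(IntermediateField.adjoin ℚ ({β} : Set (AlgebraicClosure ℚ)))) + (58489674 : 𝓞 ↥(IntermediateField.adjoin ℚ ({β} : Set (AlgebraicClosure ℚ)))) * θI + (305187959 : 𝓞 ↥(IntermediateField.adjoin ℚ ({β} : Set (AlgebraicClosure ℚ)))) * θI ^ 2))
    (μ₀ := ((32141 : 𝓞 ↥(IntermediateField.adjoin ℚ ({β} : Set (AlgebraicClosure ℚ)))) + (415 : 𝓞 ↥(IntermediateField.adjoin ℚ ({β} : Set (AlgebraicClosure ℚ)))) * θI + (2165 : 𝓞 ↥(IntermediateField.adjoin ℚ ({β} : Set (AlgebraicClosure ℚ)))) * θI ^ 2))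
    (μ₁ := ((3638 : 𝓞 ↥(IntermediateField.adjoin ℚ ({β} : Set (AlgebraicClosure ℚ)))) + (47 : 𝓞 ↥(IntermediateField.adjoin ℚ ({β} : Set (AlgebraicClosure ℚ)))) * θI + (245 : 𝓞 ↥(IntermediateField.adjoin ℚ ({β} : Set (AlgebraicClosure ℚ)))) * θI ^ 2))
    (ν₀ := ((-31534 : 𝓞 ↥(IntermediateField.adjoin ℚ ({β} : Set (AlgebraicClosure ℚ)))) + (-23132 : 𝓞 ↥(IntermediateField.adjoin ℚ ({β} : Set (AlgebraicClosure ℚ)))) * θI + (19643 : 𝓞 ↥(IntermediateField.adjoin ℚ ({β} : Set (AlgebraicClosure ℚ)))) * θI ^ 2))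
    (ν₁ := ((-20492 : 𝓞 ↥(IntermediateField.adjoin ℚ ({β} : Set (AlgebraicClosure ℚ)))) + (-22906 : 𝓞 ↥(IntermediateField.adjoin ℚ ({β} : Set (AlgebraicClosure ℚ)))) * θI + (3024 : 𝓞 ↥(IntermediateField.adjoin ℚ ({β} : Set (AlgebraicClosure ℚ)))) * θI ^ 2))
    (q₀ := ((89 : 𝓞 ↥(IntermediateField.adjoin ℚ ({β} : Set (AlgebraicClosure ℚ)))) + (1 : 𝓞 ↥(IntermediateField.adjoin ℚ ({β} : Set (AlgebraicClosure ℚ)))) * θI + (6 : 𝓞 ↥(IntermediateField.adjoin ℚ ({β} : Set (AlgebraicClosure ℚ)))) * θI ^ 2))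
    (v₀ := ((-8 : 𝓞 ↥(IntermediateField.adjoin ℚ ({β} : Set (AlgebraicClosure ℚ)))) + (0 : 𝓞 ↥(IntermediateField.adjoin ℚ ({β} : Set (AlgebraicClosure ℚ)))) * θI + (0 : 𝓞 ↥(IntermediateField.adjoin ℚ ({β} : Set (AlgebraicClosure ℚ)))) * θI ^ 2))
    (v₁ := ((1 : 𝓞 ↥(IntermediateField.adjoin ℚ ({β} : Set (AlgebraicClosure ℚ)))) + (0 : 𝓞 ↥(IntermediateField.adjoin ℚ ({β} : Set (AlgebraicClosure ℚ)))) * θI + (0 : 𝓞 ↥(IntermediateField.adjoin ℚ ({β} : Set (AlgebraicClosure ℚ)))) * θI ^ 2))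
    (α₀ := ((-73 : 𝓞 ↥(IntermediateField.adjoin ℚ ({β} : Set (AlgebraicClosure ℚ)))) + (-1 : 𝓞 ↥(IntermediateField.adjoin ℚ ({β} : Set (AlgebraicClosure ℚ)))) * θI + (-5 : 𝓞 ↥(IntermediateField.adjoin ℚ ({β} : Set (AlgebraicClosure ℚ)))) * θI ^ 2))
    (α₁ := ((-148 : 𝓞 ↥(IntermediateField.adjoin ℚ ({β} : Set (AlgebraicClosure ℚ)))) + (-2 : 𝓞 ↥(IntermediateField.adjoin ℚ ({β} : Set (AlgebraicClosure ℚ)))) * θI + (-10 : 𝓞 ↥(IntermediateField.adjoin ℚ ({β} : Set (AlgebraicClosure ℚ)))) * θI ^ 2))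
    (β₀ := ((27 : 𝓞 ↥(IntermediateField.adjoin ℚ ({β} : Set (AlgebraicClosure ℚ)))) + (23 : 𝓞 ↥(IntermediateField.adjoin ℚ ({β} : Set (AlgebraicClosure ℚ)))) * θI + (-13 : 𝓞 ↥(IntermediateField.adjoin ℚ ({β} : Set (AlgebraicClosure ℚ)))) * θI ^ 2))
    (β₁ := ((-21 : 𝓞 ↥(IntermediateField.adjoin ℚ ({β} : Set (AlgebraicClosure ℚ)))) + (12 : 𝓞 ↥(IntermediateField.adjoin ℚ ({β} : Set (AlgebraicClosure ℚ)))) * θI + (47 : 𝓞 ↥(IntermediateField.adjoin ℚ ({β} : Set (AlgebraicClosure ℚ)))) * θI ^ 2))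
    (γ₀ := ((79 : 𝓞 ↥(IntermediateField.adjoin ℚ ({β} : Set (AlgebraicClosure ℚ)))) + (1 : 𝓞 ↥(IntermediateField.adjoin ℚ ({β} : Set (AlgebraicClosure ℚ)))) * θI + (5 : 𝓞 ↥(IntermediateField.adjoin ℚ ({β} : Set (AlgebraicClosure ℚ)))) * θI ^ 2))
    (γ₁ := ((-72 : 𝓞 ↥(IntermediateField.adjoin ℚ ({β} : Set (AlgebraicClosure ℚ)))) + (-1 : 𝓞 ↥(IntermediateField.adjoin ℚ ({β} : Set (AlgebraicClosure ℚ)))) * θI + (-5 : 𝓞 ↥(IntermediateField.adjoin ℚ ({β} : Set (AlgebraicClosure ℚ)))) * θI ^ 2))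
    (δ₀ := ((-115 : 𝓞 ↥(IntermediateField.adjoin ℚ ({β} : Set (AlgebraicClosure ℚ)))) + (-135 : 𝓞 ↥(IntermediateField.adjoin ℚ ({β} : Set (AlgebraicClosure ℚ)))) * θI + (9 : 𝓞 ↥(IntermediateField.adjoin ℚ ({β} : Set (AlgebraicClosure ℚ)))) * θI ^ 2))
    (δ₁ := ((-70 : 𝓞 ↥(IntermediateField.adjoin ℚ ({β} : Set (AlgebraicClosure ℚ)))) + (29 : 𝓞 ↥(IntermediateField.adjoin ℚ ({β} : Set (AlgebraicClosure ℚ)))) * θI + (143 : 𝓞 ↥(IntermediateField.adjoin ℚ ({β} : Set (AlgebraicClosure ℚ)))) * θI ^ 2))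
    (m₀ := ((-3 : 𝓞 ↥(IntermediateField.adjoin ℚ ({β} : Set (AlgebraicClosure ℚ)))) + (-4 : 𝓞 ↥(IntermediateField.adjoin ℚ ({β} : Set (AlgebraicClosure ℚ)))) * θI + (0 : 𝓞 ↥(IntermediateField.adjoin ℚ ({β} : Set (AlgebraicClosure ℚ)))) * θI ^ 2))
    (m₁ := ((2 : 𝓞 ↥(IntermediateField.adjoin ℚ ({β} : Set (AlgebraicClosure ℚ)))) + (1 : 𝓞 ↥(IntermediateField.adjoin ℚ ({β} : Set (AlgebraicClosure ℚ)))) * θI + (-2 : 𝓞 ↥(IntermediateField.adjoin ℚ ({β} : Set (AlgebraicClosure ℚ)))) * θI ^ 2))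
    (n₀ := ((0 : 𝓞 ↥(IntermediateField.adjoin ℚ ({β} : Set (AlgebraicClosure ℚ)))) + (0 : 𝓞 ↥(IntermediateField.adjoin ℚ ({β} : Set (AlgebraicClosure ℚ)))) * θI + (4 : 𝓞 ↥(IntermediateField.adjoin ℚ ({β} : Set (AlgebraicClosure ℚ)))) * θI ^ 2))
    (n₁ := ((-3 : 𝓞 ↥(IntermediateField.adjoin ℚ ({β} : Set (AlgebraicClosure ℚ)))) + (2 : 𝓞 ↥(IntermediateField.adjoin ℚ ({β} : Set (AlgebraicClosure ℚ)))) * θI + (5 : 𝓞 ↥(IntermediateField.adjoin ℚ ({β} : Set (AlgebraicClosure ℚ)))) * θI ^ 2))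
    (l₀ := ((2 : 𝓞 ↥(IntermediateField.adjoin ℚ ({β} : Set (AlgebraicClosure ℚ)))) + (1 : 𝓞 ↥(IntermediateField.adjoin ℚ ({β} : Set (AlgebraicClosure ℚ)))) * θI + (0 : 𝓞 ↥(IntermediateField.adjoin ℚ ({β} : Set (AlgebraicClosure ℚ)))) * θI ^ 2))
    (l₁ := ((-2 : 𝓞 ↥(IntermediateField.adjoin ℚ ({β} : Set (AlgebraicClosure ℚ)))) + (2 : 𝓞 ↥(IntermediateField.adjoin ℚ ({β} : Set (AlgebraicClosure ℚ)))) * θI + (0 : 𝓞 ↥(IntermediateField.adjoin ℚ ({β} : Set (AlgebraicClosure ℚ)))) * θI ^ 2))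
    (hu1_n13971 hβ hθI) (hu2_n13971 hβ hθI) (hu3_n13971 hβ hθI) (hws_n13971 hβ hθI) (hbez_n13971 hβ hθI) (q0_ne_zero_n13971 hβ hθI)
    (hM2_n13971 hβ hθI) (hM3_n13971 hβ hθI) (hM4_n13971 hβ hθI) hcert κP hκP

end Summit.BirchSwinnertonDyer.BirchSwinnertonDyer.Theorems.AlignedTransportAtTwoCubicOrderFourRowN13971

end
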